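import Literature.Barriers.CriticalPhenomena.PlaquetteWalkHoleRootHoleColumnLimitWeight
import Literature.Barriers.CriticalPhenomena.PlaquetteWalkHoleRootHoleColumnPhasesBelow
import Literature.Barriers.CriticalPhenomena.PlaquetteWalkHoleRootHoleColumnSeven
import HarnessLib

/-!
# Barrier catalogue (SAWScalingLimit): at the two hole-column cells NEXT TO THE HOLE every wound class-`B2a` walk of limit cost `7` with a slanted end has an
arc beyond its rhombus' row — so the phase law of `PlaquetteWalkHoleRootHoleColumnLimitWeight` / `…PhasesBelow` holds there with NO structural hypothesis
(«HOLE COLUMN NEXT TO THE HOLE: THE COMPLETE PHASE LAW FOR THE SLANTED LEVEL-`7` MEMBERS»)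

`Z → ∞` limit model of the printed Yang–Baxter weights [GlazmanManolescu2019, §1, eq. (1)]; the «RECTANGLE COEFFICIENT» line (b-engine-1 g29). The chain
`PlaquetteWalkHoleRootHoleColumn{WestLeg, Loop, Climb, Top, Hook, Phases, LimitWeight, PhasesBelow}` classifies the wound class-`B2a` walks of limit cost `7` with a
slanted end at a hole-column rhombus `r = (w.1 − 1, r.2)` under two structural hypotheses: a STRAIGHT first arc at `r` (discharged by
`ΩG.not_cost_seven_slanted_turn_holeColumn`: a turning first arc costs `8` isolated turns) and SOME ARC BEYOND THE ROW OF `r` (`hup` / `hdown`). At the two cells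
ADJACENT to the hole, `r = (w.1 − 1, w.2 ± 1)` — the cells where the lane looks for `VF ≢ 0` first — the second hypothesis is automatic:

* ★★ `ΩG.far_of_slanted_holeColumn_adjacent_above` / `_below` — a class-`B2a` walk with a slanted end at `(w.1 − 1, w.2 + 1)` (resp. `(w.1 − 1, w.2 − 1)`) has an arc
  strictly above (resp. below) the row of `r`: its last plaquette is the vertical neighbour of `r` on the side of the end, and the neighbour towards the hole IS the
  hole `(w.1 − 1, w.2) ∉ D` — so the end is on the far side and the last plaquette lies beyond `r`'s row (no cost, no winding needed);
* ★★★ `ΩG.limitWeight_of_cost_seven_slanted_holeColumn_adjacent_above` — hence for EVERY wound class-`B2a` walk of limit cost `7` with a slanted end at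
  `(w.1 − 1, w.2 + 1)`: end `N`, `n_{u₁} + n_{u₂} = 7`, and with the two kiss indicators `a, b ≤ 1`: `phaseIndex = (9 + 3a + 5b) mod 8` and
  **`limitWeight = (√2)⁷ · ζ^{4((7 + 3a + 5b) mod 8)}`**; ★★★ `…_mem_…_adjacent_above`: `limitWeight ∈ {(√2)⁷ζ²⁸, (√2)⁷ζ⁸, (√2)⁷ζ¹⁶}` (census phases `7, 2, 4`) and
  `phaseIndex ∈ {1, 4, 6}`;
* ★★★ `ΩG.limitWeight_of_cost_seven_slanted_holeColumn_adjacent_below` / `…_mem_…_adjacent_below` — at `(w.1 − 1, w.2 − 1)`: end `S`, `phaseIndex = (5a + 3b) mod 8`,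
  **`limitWeight = (√2)⁷ · ζ^{4((2 + 5a + 3b) mod 8)}`** `∈ {(√2)⁷ζ⁸, (√2)⁷ζ²⁸, (√2)⁷ζ²⁰}` (census phases `2, 7, 5`), `phaseIndex ∈ {0, 3, 5}`.

So at the cells next to the hole the slanted-end class-`B2a` part of the level-`7` wound sum is supported on three phases with no antipodal pair
(`PlaquetteWalkAngleLimitAntipode.sum_phases_above_eq_zero_iff` / `…_below_…`); what remains for `Λ₇ ≠ 0` there is the vertical-end part (the class-`B2b` extensions
of the cost-`9` `NS` parents, census phases `k = 1` above / `k = 0` below, and the absence of cost-`7` vertical-end class-`B2a` members — lane census, kit j298353).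

[GlazmanManolescu2019 §1 eq. (1), Lemma 2.1, Remark 2.2, §4.2; Glazman2015WeightedSAW Lemma 3.1 (proof); the `Z → ∞` bookkeeping is lane plumbing.]
-/

noncomputable section

namespace Literature.Probability.RandomPlanarGeometry.SAW.YangBaxter

open Real
open Literature.Barriers.CriticalPhenomena.PlaquetteWalk

namespace ΩG

variable {D : Set Face} {w r : Face} {ω : ΩG D (w.side .W) r}

/-- The last plaquette of a class-`B2a` walk with a slanted end at `r`: `(r.1, r.2 + 1)` if the end is `N`, `(r.1, r.2 − 1)` if it is `S` — the vertical neighbour of `r`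
across the end. [cite: GlazmanManolescu2019, §1, Fig. 1; Lemma 2.1 (the classes of walks through a rhombus)] -/
theorem fc_last_of_slanted (hr : RootedFace D (w.side .W) r) (h : ω.IsB2a) (hz : ω.1 = .N ∨ ω.1 = .S) :
    (ω.1 = .N ∧ ω.2.fc (ω.2.arcs.length - 1) = (r.1, r.2 + 1)) ∨ (ω.1 = .S ∧ ω.2.fc (ω.2.arcs.length - 1) = (r.1, r.2 - 1)) := by
  set n := ω.2.arcs.length with hn
  have hF := ω.fh_lt h
  have hn1 : n - 1 < n := by omega
  have hlast := sOut_last_NS_of_slanted h hz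
  have hlastr := fc_last_ne_root hr h
  have hzside : (ω.2.fc (n - 1)).side (ω.2.sOut (n - 1)) = r.side ω.1 := by
    obtain ⟨-, hout⟩ := ω.2.side_sIn_eq_nth hn1
    rwa [show n - 1 + 1 = n by omega, ω.2.nth_length] at hout
  rcases hfc : ω.2.fc (n - 1) with ⟨x, y⟩
  rw [hfc] at hzside hlastr
  rcases r with ⟨r1, r2⟩
  simp only at hlastr ⊢
  generalize hs : ω.2.sOut (n - 1) = s at hzside hlast ⊢
  generalize ht : ω.1 = t at hzside hz ⊢
  rcases hz with rfl | rfl <;> rcases hlast with rfl | rfl <;>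
    simp only [Face.side, MidEdge.slant.injEq, Prod.mk.injEq, reduceCtorEq, false_and, true_and, false_or, or_false] at hzside ⊢
  · exact absurd (Prod.ext hzside.1 (by simp only; omega)) hlastr
  · refine ⟨?_, ?_⟩ <;> omega
  · refine ⟨?_, ?_⟩ <;> omega
  · exact absurd (Prod.ext hzside.1 (by simp only; omega)) hlastr

/-- ★★ **NEXT TO THE HOLE, ABOVE: THE END IS ON THE FAR SIDE.** A class-`B2a` walk from the hole root `w.side W` (hole `(w.1 − 1, w.2)` absent) with a slanted end at
the rhombus `r = (w.1 − 1, w.2 + 1)` just above the hole has an arc strictly above the row of `r` (its last plaquette): the plaquette below `r` is the hole.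
[cite: GlazmanManolescu2019, §1, Fig. 1; Lemma 2.1; Remark 2.2] -/
theorem far_of_slanted_holeColumn_adjacent_above (hh : holeFaceW w ∉ D) (hr : RootedFace D (w.side .W) r) (h : ω.IsB2a) (hz : ω.1 = .N ∨ ω.1 = .S)
    (hcol : r.1 = w.1 - 1) (hadj : r.2 = w.2 + 1) : ∃ j < ω.2.arcs.length, r.2 < (ω.2.fc j).2 := by
  have hF := ω.fh_lt h
  have hn1 : ω.2.arcs.length - 1 < ω.2.arcs.length := by omega
  rcases fc_last_of_slanted hr h hz with ⟨-, hL⟩ | ⟨-, hL⟩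
  · exact ⟨_, hn1, by rw [hL]; simp only; omega⟩
  · exfalso
    have hLD : ω.2.fc (ω.2.arcs.length - 1) ∈ D := (YBWalk.arcFace_arcAt hn1).2
    rw [hL] at hLD
    apply hh
    have e : holeFaceW w = (r.1, r.2 - 1) := by unfold holeFaceW; exact Prod.ext (by simp only; omega) (by simp only; omega)
    rw [e]; exact hLD

/-- ★★ **NEXT TO THE HOLE, BELOW: THE END IS ON THE FAR SIDE.** The same at `r = (w.1 − 1, w.2 − 1)` just below the hole: some arc lies strictly below the row of `r`.
[cite: GlazmanManolescu2019, §1, Fig. 1; Lemma 2.1; Remark 2.2; §4.2 (lattice symmetries)] -/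
theorem far_of_slanted_holeColumn_adjacent_below (hh : holeFaceW w ∉ D) (hr : RootedFace D (w.side .W) r) (h : ω.IsB2a) (hz : ω.1 = .N ∨ ω.1 = .S)
    (hcol : r.1 = w.1 - 1) (hadj : r.2 = w.2 - 1) : ∃ j < ω.2.arcs.length, (ω.2.fc j).2 < r.2 := by
  have hF := ω.fh_lt h
  have hn1 : ω.2.arcs.length - 1 < ω.2.arcs.length := by omega
  rcases fc_last_of_slanted hr h hz with ⟨-, hL⟩ | ⟨-, hL⟩
  · exfalso
    have hLD : ω.2.fc (ω.2.arcs.length - 1) ∈ D := (YBWalk.arcFace_arcAt hn1).2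
    rw [hL] at hLD
    apply hh
    have e : holeFaceW w = (r.1, r.2 + 1) := by unfold holeFaceW; exact Prod.ext (by simp only; omega) (by simp only; omega)
    rw [e]; exact hLD
  · exact ⟨_, hn1, by rw [hL]; simp only; omega⟩

/-- ★★★ **NEXT TO THE HOLE, ABOVE: THE LIMIT WEIGHT OF EVERY SLANTED LEVEL-`7` MEMBER.** For a wound class-`B2a` walk of limit cost `7` from the hole root `w.side W`
(hole `(w.1 − 1, w.2)` absent) with a slanted end at `r = (w.1 − 1, w.2 + 1)` — no further hypothesis —: the end is `N`, `n_{u₁} + n_{u₂} = 7`, and with `a = 1` iff a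
root-row plaquette is visited twice and `b = 1` iff a plaquette of `r`'s row is visited twice (`a, b ≤ 1`), `phaseIndex = (9 + 3a + 5b) mod 8` and
**`limitWeight = (√2)⁷ · ζ^{4((7 + 3a + 5b) mod 8)}`** (`ζ = e^{iπ/16}`). The first arc at `r` is straight by `not_cost_seven_slanted_turn_holeColumn`, an arc above
`r`'s row exists by `far_of_slanted_holeColumn_adjacent_above`, and `limitWeight_of_cost_seven_straight_holeColumn_above` applies.
[cite: GlazmanManolescu2019, §1, Fig. 1 and eq. (1); Lemma 2.1, eq. (CR); §2.1, eq. (2.1)] [cite: Glazman2015WeightedSAW, Lemma 3.1 (proof, pp. 6–7)] -/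
theorem limitWeight_of_cost_seven_slanted_holeColumn_adjacent_above (hh : holeFaceW w ∉ D) (hr : RootedFace D (w.side .W) r) (h : ω.IsB2a)
    (hA : ω.AJ hr h (toC (midPt (w.side .W))) ≠ 0) (hc : cost (slotOfSide ω.1) ω.2.mids = 7) (hz : ω.1 = .N ∨ ω.1 = .S)
    (hcol : r.1 = w.1 - 1) (hadj : r.2 = w.2 + 1) :
    ω.1 = .N ∧ cfgCount ω.2.mids [.corner] + cfgCount ω.2.mids [.coCorner] = 7 ∧
    ∃ a b : ℕ, a ≤ 1 ∧ b ≤ 1 ∧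
      ((a = 1 ↔ ∃ l l' : ℕ, l < ω.2.arcs.length ∧ l' < ω.2.arcs.length ∧ l ≠ l' ∧ ω.2.fc l = ω.2.fc l' ∧ (ω.2.fc l).2 = w.2) ∧
        (b = 1 ↔ ∃ l l' : ℕ, l < ω.2.arcs.length ∧ l' < ω.2.arcs.length ∧ l ≠ l' ∧ ω.2.fc l = ω.2.fc l' ∧ (ω.2.fc l).2 = r.2)) ∧
      phaseIndex ω.2.mids = (9 + 3 * a + 5 * b) % 8 ∧
      limitWeight (slotOfSide ω.1) ω.2.mids = ((Real.sqrt 2 : ℝ) : ℂ) ^ 7 * zeta32 ^ (4 * ((7 + 3 * a + 5 * b) % 8)) := by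
  have hstr8 : arcKind (ω.2.sIn ω.2.firstHitG) (ω.2.sOut ω.2.firstHitG) = .straight := by
    by_contra hNS
    exact not_cost_seven_slanted_turn_holeColumn hh hr h hA hc hz hNS hcol
  have habove : w.2 < r.2 := by omega
  have hup := far_of_slanted_holeColumn_adjacent_above hh hr h hz hcol hadj
  obtain ⟨hN, hm⟩ := isolated_eq_seven_of_cost_seven_straight_holeColumn_above hh hr h hA hc hz hstr8 hcol habove hup
  exact ⟨hN, hm, limitWeight_of_cost_seven_straight_holeColumn_above hh hr h hA hc hz hstr8 hcol habove hup⟩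

/-- ★★★ **NEXT TO THE HOLE, ABOVE: THREE PHASES, NO ANTIPODAL PAIR.** Every wound class-`B2a` walk of limit cost `7` with a slanted end at `(w.1 − 1, w.2 + 1)` has
`limitWeight ∈ {(√2)⁷ζ²⁸, (√2)⁷ζ⁸, (√2)⁷ζ¹⁶}` (census phases `7, 2, 4`) and `phaseIndex ∈ {1, 4, 6}`.
[cite: GlazmanManolescu2019, §1, Fig. 1 and eq. (1); Lemma 2.1, eq. (CR); §2.1, eq. (2.1)] [cite: Glazman2015WeightedSAW, Lemma 3.1 (proof, pp. 6–7)] -/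
theorem limitWeight_mem_of_cost_seven_slanted_holeColumn_adjacent_above (hh : holeFaceW w ∉ D) (hr : RootedFace D (w.side .W) r) (h : ω.IsB2a)
    (hA : ω.AJ hr h (toC (midPt (w.side .W))) ≠ 0) (hc : cost (slotOfSide ω.1) ω.2.mids = 7) (hz : ω.1 = .N ∨ ω.1 = .S)
    (hcol : r.1 = w.1 - 1) (hadj : r.2 = w.2 + 1) :
    (limitWeight (slotOfSide ω.1) ω.2.mids = ((Real.sqrt 2 : ℝ) : ℂ) ^ 7 * zeta32 ^ 28 ∨
      limitWeight (slotOfSide ω.1) ω.2.mids = ((Real.sqrt 2 : ℝ) : ℂ) ^ 7 * zeta32 ^ 8 ∨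
      limitWeight (slotOfSide ω.1) ω.2.mids = ((Real.sqrt 2 : ℝ) : ℂ) ^ 7 * zeta32 ^ 16) ∧
    (phaseIndex ω.2.mids = 1 ∨ phaseIndex ω.2.mids = 4 ∨ phaseIndex ω.2.mids = 6) := by
  obtain ⟨-, -, a, b, ha, hb, -, hX, hlw⟩ := limitWeight_of_cost_seven_slanted_holeColumn_adjacent_above hh hr h hA hc hz hcol hadj
  rw [hlw, hX]
  interval_cases a <;> interval_cases b <;> norm_num

/-- ★★★ **NEXT TO THE HOLE, BELOW: THE LIMIT WEIGHT OF EVERY SLANTED LEVEL-`7` MEMBER.** For a wound class-`B2a` walk of limit cost `7` from the hole root with a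
slanted end at `r = (w.1 − 1, w.2 − 1)`: the end is `S`, `n_{u₁} + n_{u₂} = 7`, and with the kiss indicators `a` (root row), `b` (row of `r`):
`phaseIndex = (5a + 3b) mod 8` and **`limitWeight = (√2)⁷ · ζ^{4((2 + 5a + 3b) mod 8)}`** — by `not_cost_seven_slanted_turn_holeColumn`,
`far_of_slanted_holeColumn_adjacent_below` and `limitWeight_of_cost_seven_straight_holeColumn_below`. [cite: GlazmanManolescu2019, §1, Fig. 1 and eq. (1);
Lemma 2.1, eq. (CR); §2.1, eq. (2.1); §4.2 (lattice symmetries)] [cite: Glazman2015WeightedSAW, Lemma 3.1 (proof, pp. 6–7)] -/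
theorem limitWeight_of_cost_seven_slanted_holeColumn_adjacent_below (hh : holeFaceW w ∉ D) (hr : RootedFace D (w.side .W) r) (h : ω.IsB2a)
    (hA : ω.AJ hr h (toC (midPt (w.side .W))) ≠ 0) (hc : cost (slotOfSide ω.1) ω.2.mids = 7) (hz : ω.1 = .N ∨ ω.1 = .S)
    (hcol : r.1 = w.1 - 1) (hadj : r.2 = w.2 - 1) :
    ω.1 = .S ∧ cfgCount ω.2.mids [.corner] + cfgCount ω.2.mids [.coCorner] = 7 ∧
    ∃ a b : ℕ, a ≤ 1 ∧ b ≤ 1 ∧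
      ((a = 1 ↔ ∃ l l' : ℕ, l < ω.2.arcs.length ∧ l' < ω.2.arcs.length ∧ l ≠ l' ∧ ω.2.fc l = ω.2.fc l' ∧ (ω.2.fc l).2 = w.2) ∧
        (b = 1 ↔ ∃ l l' : ℕ, l < ω.2.arcs.length ∧ l' < ω.2.arcs.length ∧ l ≠ l' ∧ ω.2.fc l = ω.2.fc l' ∧ (ω.2.fc l).2 = r.2)) ∧
      phaseIndex ω.2.mids = (5 * a + 3 * b) % 8 ∧
      limitWeight (slotOfSide ω.1) ω.2.mids = ((Real.sqrt 2 : ℝ) : ℂ) ^ 7 * zeta32 ^ (4 * ((2 + 5 * a + 3 * b) % 8)) := by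
  have hstr8 : arcKind (ω.2.sIn ω.2.firstHitG) (ω.2.sOut ω.2.firstHitG) = .straight := by
    by_contra hNS
    exact not_cost_seven_slanted_turn_holeColumn hh hr h hA hc hz hNS hcol
  have hbelow : r.2 < w.2 := by omega
  have hdown := far_of_slanted_holeColumn_adjacent_below hh hr h hz hcol hadj
  exact limitWeight_of_cost_seven_straight_holeColumn_below hh hr h hA hc hz hstr8 hcol hbelow hdown

/-- ★★★ **NEXT TO THE HOLE, BELOW: THREE PHASES, NO ANTIPODAL PAIR.** Every wound class-`B2a` walk of limit cost `7` with a slanted end at `(w.1 − 1, w.2 − 1)` has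
`limitWeight ∈ {(√2)⁷ζ⁸, (√2)⁷ζ²⁸, (√2)⁷ζ²⁰}` (census phases `2, 7, 5`) and `phaseIndex ∈ {0, 3, 5}`.
[cite: GlazmanManolescu2019, §1, Fig. 1 and eq. (1); Lemma 2.1, eq. (CR); §2.1, eq. (2.1); §4.2] [cite: Glazman2015WeightedSAW, Lemma 3.1 (proof, pp. 6–7)] -/
theorem limitWeight_mem_of_cost_seven_slanted_holeColumn_adjacent_below (hh : holeFaceW w ∉ D) (hr : RootedFace D (w.side .W) r) (h : ω.IsB2a)
    (hA : ω.AJ hr h (toC (midPt (w.side .W))) ≠ 0) (hc : cost (slotOfSide ω.1) ω.2.mids = 7) (hz : ω.1 = .N ∨ ω.1 = .S)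
    (hcol : r.1 = w.1 - 1) (hadj : r.2 = w.2 - 1) :
    (limitWeight (slotOfSide ω.1) ω.2.mids = ((Real.sqrt 2 : ℝ) : ℂ) ^ 7 * zeta32 ^ 8 ∨
      limitWeight (slotOfSide ω.1) ω.2.mids = ((Real.sqrt 2 : ℝ) : ℂ) ^ 7 * zeta32 ^ 28 ∨
      limitWeight (slotOfSide ω.1) ω.2.mids = ((Real.sqrt 2 : ℝ) : ℂ) ^ 7 * zeta32 ^ 20) ∧
    (phaseIndex ω.2.mids = 0 ∨ phaseIndex ω.2.mids = 3 ∨ phaseIndex ω.2.mids = 5) := by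
  obtain ⟨-, -, a, b, ha, hb, -, hX, hlw⟩ := limitWeight_of_cost_seven_slanted_holeColumn_adjacent_below hh hr h hA hc hz hcol hadj
  rw [hlw, hX]
  interval_cases a <;> interval_cases b <;> norm_num

end ΩG

end Literature.Probability.RandomPlanarGeometry.SAW.YangBaxter
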